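/-
Copyright (c) 2026 the pub-hodgecm-mathlib formalisation cell (harness21).  Prover seat hodgecm-mathlib-LA5-p02 (g2), H1-DIM cut
(B-p04 (g42) plan 2026-09-02T03:20:08Z, FILE 3 «NIL-alg»).  KERNEL: theorems only, Mathlib only.
-/
import Mathlib.Algebra.Homology.HomologicalComplex
import Mathlib.Algebra.Category.ModuleCat.Basic
import Mathlib.RingTheory.Ideal.Colon
import Mathlib.RingTheory.Ideal.Operations
import Mathlib.RingTheory.LocalRing.MaximalIdeal.Basic
import HarnessLib

/-!
# Power-torsion of an element modulo a submodule (of cocycles modulo coboundaries) for a set of scalars passes to the radical of the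
# ideal they span ([AtiyahMacdonald1969] Ch. 1 (radical of an ideal, Ex. 1.13); [MumfordAV1970] §13, «the cohomology is supported at the closed point»)

Layer `Literature/Algebra/Homology`, namespace `Literature.Algebra.Homology`.  THEOREMS ONLY (no definition, no named fact, no instance, no
notation, no `sorry`), Mathlib only.  Cell `hodgecm-mathlib`, junction «NIL-alg» (FILE 3) of the duality-free «H1-DIM any characteristic» cut
(B-p04 memo v4 ∕ plan 2026-09-02T03:20:08Z): the acyclicity lemma ★ `exactAt_of_isWeaklyRegular_of_flat_of_locallyNilpotent` (B1) and the
wiring ★ `homComplex_baseChangeComplex_exactAt_of_torsion` consume, for every member `r` of a weakly regular sequence `rs ⊆ 𝔪_R`, the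
POWER-TORSION hypothesis
`hnil : ∀ r ∈ rs, ∀ i j l, i + 1 = j → j + 1 = l → ∀ z : Kʲ, d z = 0 → ∃ (k : ℕ) (w : Kⁱ), r ^ k • z = d w`,
while geometry («the cohomology of `R ⊗ K•` is supported at the closed point», [MumfordAV1970] §13) delivers it for SOME generators of the
maximal ideal.  This file is the one-line commutative algebra in between: for a fixed `z` and submodule `N` the set
`{r | ∃ k, r ^ k • z ∈ N}` is the radical of the colon ideal `(N : z) = N.colon {z}`, hence an ideal, hence contains the radical of the span of any
subset it contains.

* §1 **`exists_pow_smul_mem_iff_mem_radical_colon`** — `(∃ k, r ^ k • z ∈ N) ↔ r ∈ (N.colon {z}).radical`.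
* §1 **`exists_pow_smul_mem_of_mem_radical_span`**, `exists_pow_smul_mem_of_mem_span` — if every `r ∈ S` has a power carrying `z` into `N`, so
  does every `r ∈ (Ideal.span S).radical` (in particular every `r ∈ Ideal.span S`).
* §2 **`locallyNilpotent_cocycles_of_mem_radical_span`**, `locallyNilpotent_cocycles_of_mem_span` — the same for a cochain complex
  `K : CochainComplex (ModuleCat R) ℤ` in the VERBATIM `hnil` currency of ★ B1 (cocycles `z : K.X j`, `(K.d j l).hom z = 0`, conclusion
  `∃ (k : ℕ) (w : K.X i), r ^ k • z = (K.d i j).hom w`), from a set `S` of scalars to `(Ideal.span S).radical` ∕ `Ideal.span S`.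
* §3 `locallyNilpotent_cocycles_of_span_eq_top_of_mem` — if `S` spans an ideal `I` (`Ideal.span S = I`, e.g. generators of `𝔪_R`) then `hnil`
  holds for every `r ∈ I`, hence (`locallyNilpotent_cocycles_list_of_subset`) for every list `rs` with `↑rs ⊆ I` — the shape (B1)∕(h₂-WIRING) eat;
  `locallyNilpotent_cocycles_of_maximalIdeal` — the local-ring spelling with `I = IsLocalRing.maximalIdeal R`.
* §4 (ED. 2) `locallyNilpotent_cocycles_of_mem_map`, `…_of_mem_map_span`, **`locallyNilpotent_cocycles_of_map_eq`**, `…_of_span_eq_of_map_eq` —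
  ALONG A RING MAP `f : A →+* R`: `hnil` for `f a`, `a ∈ I` (or `a` in a generating set of `I`) ⇒ `hnil` on `I.map f` ∕ on `J = I.map f` — the
  `hmax : (ker t₀♯).map (algebraMap Γ(T) R) = 𝔪_R` shape of ★ `PoincareGrothendieckComplexResidueFieldRepr`.

HC_CM is proved only modulo the 7 printed citations until rung 0 closes; nothing here bears on a summit statement (count-neutral capital).

## References
* [AtiyahMacdonald1969] M. F. Atiyah, I. G. Macdonald, *Introduction to commutative algebra* (1969), Ch. 1, radical of an ideal (p. 8–9),
  Ex. 1.13; Ch. 4 (primary decomposition: `r(𝔞 : x)`).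
* [MumfordAV1970] D. Mumford, *Abelian Varieties* (1970), §13 (pp. 125–130).
-/

set_option autoImplicit false

universe u v

open CategoryTheory HomologicalComplex

noncomputable section

namespace Literature.Algebra.Homology

/-! ## §1 Module level: `{r | ∃ k, r ^ k • z ∈ N} = √(N : z)` -/

section Module

variable {R : Type u} [CommRing R] {M : Type v} [AddCommGroup M] [Module R M] (N : Submodule R M) (z : M)

/-- **`(∃ k, r ^ k • z ∈ N) ↔ r ∈ √(N : z)`** — the scalars some power of which carries `z` into `N` form the radical of the colon
ideal `N.colon {z}`, in particular an ideal (Mathlib `Submodule.mem_colon_singleton`, `Ideal.mem_radical_iff`).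
[cite: AtiyahMacdonald1969, Ch. 1 (p. 8–9), Ex. 1.13] -/
theorem exists_pow_smul_mem_iff_mem_radical_colon (r : R) : (∃ k : ℕ, r ^ k • z ∈ N) ↔ r ∈ (N.colon {z}).radical := by
  simp only [Ideal.mem_radical_iff, Submodule.mem_colon_singleton]

/-- **FROM A SET OF SCALARS TO THE RADICAL OF ITS SPAN**: if every `r ∈ S` has a power carrying `z` into `N`, then so does every
`r ∈ √(Ideal.span S)`. [cite: AtiyahMacdonald1969, Ch. 1 (p. 8–9), Ex. 1.13] -/
theorem exists_pow_smul_mem_of_mem_radical_span {S : Set R} (hS : ∀ r ∈ S, ∃ k : ℕ, r ^ k • z ∈ N) {r : R}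
    (hr : r ∈ (Ideal.span S).radical) : ∃ k : ℕ, r ^ k • z ∈ N := by
  rw [exists_pow_smul_mem_iff_mem_radical_colon]
  have hle : Ideal.span S ≤ (N.colon {z}).radical :=
    Ideal.span_le.mpr fun s hs => (exists_pow_smul_mem_iff_mem_radical_colon N z s).mp (hS s hs)
  exact (Ideal.radical_idem (N.colon {z})) ▸ Ideal.radical_mono hle hr

/-- If every `r ∈ S` has a power carrying `z` into `N`, then so does every `r ∈ Ideal.span S`.
[cite: AtiyahMacdonald1969, Ch. 1 (p. 8–9), Ex. 1.13] -/
theorem exists_pow_smul_mem_of_mem_span {S : Set R} (hS : ∀ r ∈ S, ∃ k : ℕ, r ^ k • z ∈ N) {r : R} (hr : r ∈ Ideal.span S) :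
    ∃ k : ℕ, r ^ k • z ∈ N :=
  exists_pow_smul_mem_of_mem_radical_span N z hS (Ideal.le_radical hr)

end Module

/-! ## §2 Complex level, in the `hnil` currency of the acyclicity lemma (B1) -/

section Complex

variable {R : Type u} [CommRing R] (K : CochainComplex (ModuleCat.{u} R) ℤ)

/-- **POWER-TORSION OF COCYCLES MODULO COBOUNDARIES PASSES TO THE RADICAL OF THE SPAN**: if for every `r ∈ S` every cocycle `z ∈ Kʲ`
(`d z = 0`) has a power `r ^ k • z` which is a coboundary, then the same holds for every `r ∈ √(Ideal.span S)` — in the VERBATIM `hnil`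
currency of ★ `exactAt_of_isWeaklyRegular_of_flat_of_locallyNilpotent`.
[cite: AtiyahMacdonald1969, Ch. 1 (p. 8–9), Ex. 1.13] [cite: MumfordAV1970, §13 (pp. 125–130)] -/
theorem locallyNilpotent_cocycles_of_mem_radical_span {S : Set R}
    (hS : ∀ r ∈ S, ∀ (i j l : ℤ), i + 1 = j → j + 1 = l → ∀ z : K.X j, (K.d j l).hom z = 0 →
      ∃ (k : ℕ) (w : K.X i), r ^ k • z = (K.d i j).hom w) :
    ∀ r ∈ (Ideal.span S).radical, ∀ (i j l : ℤ), i + 1 = j → j + 1 = l → ∀ z : K.X j, (K.d j l).hom z = 0 →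
      ∃ (k : ℕ) (w : K.X i), r ^ k • z = (K.d i j).hom w := by
  intro r hr i j l hij hjl z hz
  have hS' : ∀ s ∈ S, ∃ k : ℕ, s ^ k • z ∈ LinearMap.range (K.d i j).hom := by
    intro s hs
    obtain ⟨k, w, hw⟩ := hS s hs i j l hij hjl z hz
    exact ⟨k, w, hw.symm⟩
  obtain ⟨k, w, hw⟩ := exists_pow_smul_mem_of_mem_radical_span (LinearMap.range (K.d i j).hom) z hS' hr
  exact ⟨k, w, hw.symm⟩

/-- If for every `r ∈ S` every cocycle has a power `r ^ k • z` which is a coboundary, then the same holds for every `r ∈ Ideal.span S`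
(`hnil` currency of ★ B1). [cite: AtiyahMacdonald1969, Ch. 1 (p. 8–9), Ex. 1.13] [cite: MumfordAV1970, §13 (pp. 125–130)] -/
theorem locallyNilpotent_cocycles_of_mem_span {S : Set R}
    (hS : ∀ r ∈ S, ∀ (i j l : ℤ), i + 1 = j → j + 1 = l → ∀ z : K.X j, (K.d j l).hom z = 0 →
      ∃ (k : ℕ) (w : K.X i), r ^ k • z = (K.d i j).hom w) :
    ∀ r ∈ Ideal.span S, ∀ (i j l : ℤ), i + 1 = j → j + 1 = l → ∀ z : K.X j, (K.d j l).hom z = 0 →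
      ∃ (k : ℕ) (w : K.X i), r ^ k • z = (K.d i j).hom w :=
  fun r hr => locallyNilpotent_cocycles_of_mem_radical_span K hS r (Ideal.le_radical hr)

/-! ## §3 Generators of an ideal ∕ of the maximal ideal; lists -/

/-- If `S` generates the ideal `I` and `hnil` holds for every `r ∈ S`, then `hnil` holds for every `r ∈ I`.
[cite: AtiyahMacdonald1969, Ch. 1 (p. 8–9), Ex. 1.13] [cite: MumfordAV1970, §13 (pp. 125–130)] -/
theorem locallyNilpotent_cocycles_of_span_eq_of_mem {S : Set R} {I : Ideal R} (hSI : Ideal.span S = I)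
    (hS : ∀ r ∈ S, ∀ (i j l : ℤ), i + 1 = j → j + 1 = l → ∀ z : K.X j, (K.d j l).hom z = 0 →
      ∃ (k : ℕ) (w : K.X i), r ^ k • z = (K.d i j).hom w) :
    ∀ r ∈ I, ∀ (i j l : ℤ), i + 1 = j → j + 1 = l → ∀ z : K.X j, (K.d j l).hom z = 0 →
      ∃ (k : ℕ) (w : K.X i), r ^ k • z = (K.d i j).hom w :=
  fun r hr => locallyNilpotent_cocycles_of_mem_span K hS r (hSI ▸ hr)

/-- **THE SHAPE (B1) ∕ (h₂-WIRING) EAT**: if `hnil` holds for every member of an ideal `I` (e.g. by the previous theorem), it holds for every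
member of any list `rs` with `↑rs ⊆ I` — e.g. a weakly regular sequence ∕ regular system of parameters inside `𝔪_R`.
[cite: MumfordAV1970, §13 (pp. 125–130)] -/
theorem locallyNilpotent_cocycles_list_of_subset {I : Ideal R} (rs : List R) (hrs : ∀ r ∈ rs, r ∈ I)
    (hI : ∀ r ∈ I, ∀ (i j l : ℤ), i + 1 = j → j + 1 = l → ∀ z : K.X j, (K.d j l).hom z = 0 →
      ∃ (k : ℕ) (w : K.X i), r ^ k • z = (K.d i j).hom w) :
    ∀ r ∈ rs, ∀ (i j l : ℤ), i + 1 = j → j + 1 = l → ∀ z : K.X j, (K.d j l).hom z = 0 →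
      ∃ (k : ℕ) (w : K.X i), r ^ k • z = (K.d i j).hom w :=
  fun r hr => hI r (hrs r hr)

/-- **LOCAL-RING SPELLING**: if `S ⊆ R` generates the maximal ideal of a local ring `R` (`Ideal.span S = 𝔪_R`) and `hnil` holds for every
`r ∈ S`, then `hnil` holds for every `r ∈ 𝔪_R` — hence for every weakly regular sequence ∕ r.s.p. `rs ⊆ 𝔪_R` by
`locallyNilpotent_cocycles_list_of_subset`. [cite: MumfordAV1970, §13 (pp. 125–130)] [cite: AtiyahMacdonald1969, Ch. 1 (p. 8–9), Ex. 1.13] -/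
theorem locallyNilpotent_cocycles_of_maximalIdeal [IsLocalRing R] {S : Set R} (hS𝔪 : Ideal.span S = IsLocalRing.maximalIdeal R)
    (hS : ∀ r ∈ S, ∀ (i j l : ℤ), i + 1 = j → j + 1 = l → ∀ z : K.X j, (K.d j l).hom z = 0 →
      ∃ (k : ℕ) (w : K.X i), r ^ k • z = (K.d i j).hom w) :
    ∀ r ∈ IsLocalRing.maximalIdeal R, ∀ (i j l : ℤ), i + 1 = j → j + 1 = l → ∀ z : K.X j, (K.d j l).hom z = 0 →
      ∃ (k : ℕ) (w : K.X i), r ^ k • z = (K.d i j).hom w :=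
  locallyNilpotent_cocycles_of_span_eq_of_mem K hS𝔪 hS

/-- **RADICAL SPELLING** (the strongest form): if `hnil` holds for every `r ∈ S` and `√(Ideal.span S) = 𝔪_R` (e.g. `S` cuts out the closed
point set-theoretically: an ideal of definition), then `hnil` holds for every `r ∈ 𝔪_R`.
[cite: AtiyahMacdonald1969, Ch. 1 (p. 8–9), Ex. 1.13] [cite: MumfordAV1970, §13 (pp. 125–130)] -/
theorem locallyNilpotent_cocycles_of_radical_span_eq [IsLocalRing R] {S : Set R}
    (hS𝔪 : (Ideal.span S).radical = IsLocalRing.maximalIdeal R)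
    (hS : ∀ r ∈ S, ∀ (i j l : ℤ), i + 1 = j → j + 1 = l → ∀ z : K.X j, (K.d j l).hom z = 0 →
      ∃ (k : ℕ) (w : K.X i), r ^ k • z = (K.d i j).hom w) :
    ∀ r ∈ IsLocalRing.maximalIdeal R, ∀ (i j l : ℤ), i + 1 = j → j + 1 = l → ∀ z : K.X j, (K.d j l).hom z = 0 →
      ∃ (k : ℕ) (w : K.X i), r ^ k • z = (K.d i j).hom w :=
  fun r hr => locallyNilpotent_cocycles_of_mem_radical_span K hS r (hS𝔪 ▸ hr)

end Complex


/-! ## §4 (ED. 2) Along a ring map: `hnil` on an ideal `I ⊆ A` (or on generators of `I`) ⇒ `hnil` on `I.map f` — the `hmax` shape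
`(ker t₀♯).map (algebraMap Γ(T) R) = 𝔪_R` of ★ `PoincareGrothendieckComplexResidueFieldRepr` -/

section RingMap

variable {A : Type v} [CommRing A] {R : Type u} [CommRing R] (f : A →+* R) (K : CochainComplex (ModuleCat.{u} R) ℤ)

/-- **ALONG A RING MAP**: if `hnil` holds for `f a` for every `a` in an ideal `I ⊆ A`, then it holds for every `r ∈ I.map f` (Mathlib:
`Ideal.map f I = Ideal.span (f '' I)`).  With `I = ker t₀♯`, `f = algebraMap Γ(T) R` and ★ `hmax : I.map f = 𝔪_R` this is «nilpotent on the
pulled-back coordinate functions ⇒ nilpotent on all of `𝔪_R`». [cite: AtiyahMacdonald1969, Ch. 1 (p. 8–9), Ex. 1.13] [cite: MumfordAV1970, §13 (pp. 125–130)] -/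
theorem locallyNilpotent_cocycles_of_mem_map {I : Ideal A}
    (hI : ∀ a ∈ I, ∀ (i j l : ℤ), i + 1 = j → j + 1 = l → ∀ z : K.X j, (K.d j l).hom z = 0 →
      ∃ (k : ℕ) (w : K.X i), f a ^ k • z = (K.d i j).hom w) :
    ∀ r ∈ I.map f, ∀ (i j l : ℤ), i + 1 = j → j + 1 = l → ∀ z : K.X j, (K.d j l).hom z = 0 →
      ∃ (k : ℕ) (w : K.X i), r ^ k • z = (K.d i j).hom w := by
  refine locallyNilpotent_cocycles_of_mem_span K (S := f '' (I : Set A)) ?_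
  rintro _ ⟨a, ha, rfl⟩
  exact hI a ha

/-- Along a ring map, from GENERATORS: if `I = Ideal.span G` and `hnil` holds for `f a`, `a ∈ G`, then it holds for every `r ∈ I.map f`
(Mathlib `Ideal.map_span`). [cite: AtiyahMacdonald1969, Ch. 1 (p. 8–9), Ex. 1.13] [cite: MumfordAV1970, §13 (pp. 125–130)] -/
theorem locallyNilpotent_cocycles_of_mem_map_span {G : Set A}
    (hG : ∀ a ∈ G, ∀ (i j l : ℤ), i + 1 = j → j + 1 = l → ∀ z : K.X j, (K.d j l).hom z = 0 →
      ∃ (k : ℕ) (w : K.X i), f a ^ k • z = (K.d i j).hom w) :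
    ∀ r ∈ (Ideal.span G).map f, ∀ (i j l : ℤ), i + 1 = j → j + 1 = l → ∀ z : K.X j, (K.d j l).hom z = 0 →
      ∃ (k : ℕ) (w : K.X i), r ^ k • z = (K.d i j).hom w := by
  rw [Ideal.map_span]
  refine locallyNilpotent_cocycles_of_mem_span K (S := f '' G) ?_
  rintro _ ⟨a, ha, rfl⟩
  exact hG a ha

/-- **THE `hmax` SHAPE**: if `I.map f = J` (e.g. ★ `hmax : (ker t₀♯).map (algebraMap Γ(T) R) = maximalIdeal R`) and `hnil` holds for `f a`,
`a ∈ I`, then `hnil` holds for every `r ∈ J` — and then for every list `rs ⊆ J` by `locallyNilpotent_cocycles_list_of_subset`.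
[cite: MumfordAV1970, §13 (pp. 125–130)] [cite: AtiyahMacdonald1969, Ch. 1 (p. 8–9), Ex. 1.13] -/
theorem locallyNilpotent_cocycles_of_map_eq {I : Ideal A} {J : Ideal R} (hIJ : I.map f = J)
    (hI : ∀ a ∈ I, ∀ (i j l : ℤ), i + 1 = j → j + 1 = l → ∀ z : K.X j, (K.d j l).hom z = 0 →
      ∃ (k : ℕ) (w : K.X i), f a ^ k • z = (K.d i j).hom w) :
    ∀ r ∈ J, ∀ (i j l : ℤ), i + 1 = j → j + 1 = l → ∀ z : K.X j, (K.d j l).hom z = 0 →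
      ∃ (k : ℕ) (w : K.X i), r ^ k • z = (K.d i j).hom w :=
  fun r hr => locallyNilpotent_cocycles_of_mem_map f K hI r (hIJ ▸ hr)

/-- The `hmax` shape from GENERATORS of `I`: `Ideal.span G = I`, `I.map f = J`, `hnil` for `f a` (`a ∈ G`) ⇒ `hnil` on `J`.
[cite: MumfordAV1970, §13 (pp. 125–130)] [cite: AtiyahMacdonald1969, Ch. 1 (p. 8–9), Ex. 1.13] -/
theorem locallyNilpotent_cocycles_of_span_eq_of_map_eq {G : Set A} {I : Ideal A} {J : Ideal R} (hGI : Ideal.span G = I)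
    (hIJ : I.map f = J)
    (hG : ∀ a ∈ G, ∀ (i j l : ℤ), i + 1 = j → j + 1 = l → ∀ z : K.X j, (K.d j l).hom z = 0 →
      ∃ (k : ℕ) (w : K.X i), f a ^ k • z = (K.d i j).hom w) :
    ∀ r ∈ J, ∀ (i j l : ℤ), i + 1 = j → j + 1 = l → ∀ z : K.X j, (K.d j l).hom z = 0 →
      ∃ (k : ℕ) (w : K.X i), r ^ k • z = (K.d i j).hom w := by
  subst hGI
  exact fun r hr => locallyNilpotent_cocycles_of_mem_map_span f K hG r (hIJ ▸ hr)

end RingMap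

end Literature.Algebra.Homology

end
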